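import Summits.QuantumFields.BalabanUV.Beta.StraightColumnK1Row

/-!
# `BalabanUV.Beta.StraightSourceK1Row` — binder row D1 ∕ (C1) OWNER an2 (gen 60), PART 5: **(K1) AT DEPTH 1 ON `ℤ^{d+1}` FOR THE STRAIGHT MINIMISER OF
# EVERY FINITELY SUPPORTED COARSE SOURCE** — PART 3 (`StraightColumnK1Row`, one column `ℋ_N(·; μ₀, q)`) extended by superposition to
# `h := ResolventComposition.HcolSum T c = Σ_{t ∈ T} c t · ℋ_N(·; t)` (an5's minimiser superposition, the depth-1 shadow of the END wrapper's nested column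
# `hv B v` for an arbitrary top source `v`): `λ′ = −Φ^{H}_{T,c}` (minus the superposition's own multiplier `HΦcolSum T c`), and
# `(E″(1) h)(u) = −N^{d+1} · Σ'_y Σ_μ λ′(μ,y) · symLinKerAt (toSite r) N μ y u = −Σ' Σ λ′ · linCountAt = −Σ' Σ λ′ · straightCount`

HONEST FRAMING (cell charter, verbatim): «discharging `BetaPertH` makes Bałaban's UV stability UNCONDITIONAL — a real constructive-QFT result; it
is NOT the continuum limit and NOT the Clay problem.»  THIS MODULE DISCHARGES NOTHING of `BetaPertH` ∕ row D1 and NOT the END wrapper's (K1) (tower torus,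
nested column, periodised coefficients — DISPLAYED at every depth); it is the `ℤ^{d+1}` ∕ depth-1 ∕ straight-chart row for every finitely supported source.
[folklore] Green's identities over the cell's OWN objects BY NAME (an5's `HcolSum ∕ HΦcolSum` with (EL) `curvAdj_curv_HcolSum`, (Q) `contourSum_HcolSum`,
`HcolSum_bdd_summable`, `tsum_sum_mul_indicator`; the GAN24 swarm's `wΦ_symm`; parts 1–3).  0 `def`, 0 `def … : Prop`, 0 sorry, nothing cited; no table VALUE,
no estimate.  NOT (C1), NOT the wrapper's (K1), NOT D1, NEVER «G-an2-4 closed», NOT BetaPertH, NOT continuum, NOT Clay.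

WHAT (all [folklore]; `[NeZero N]`; `λ′(μ,y) := Σ'_x Σ_{κ′} lamCoeffOf (KInv N) N μ y κ′ x · HcolSum T c κ′ x`):
* §1 **`lamCovector_HcolSum : λ′(μ, y) = −HΦcolSum T c μ y`**, `abs_lamCovector_HcolSum_le`, `codiff₁_lamCovector_HcolSum`.
* §2 **`curvAdj_curv_HcolSum_apply_eq_pairing_straightCount`**, `lip1_lamCovector_HcolSum_straightCount`, **`K1_row_straight_source_sym`** (`α = −N^{d+1}`),
  `K1_row_straight_source_sym'` (display order `Σ_μ Σ'_y`), **`K1_row_straight_source_comb`** (`α = −1`), `K1_row_straight_source_straight`.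

HONEST DEPENDENCY (verbatim): «continuum YM on T⁴ ⇐ BetaPertH ∧ nine spine estimates (0/9 proved); BetaPertH ⇐ (D1) ∧ (D4) ∧ CAP+tail;
G-an2-4 gates asym, D1 and NE2/3/4.»  ABSOLUTE RULE (cell, verbatim): «No internally-minted statement may enter as a cited fact. Every
hypothesis is either kernel-proved in this package or a verbatim quotation of a PUBLISHED theorem with page reference.»
Unit `b2b-balaban-beta-an2` gen 60 (row-D1 owner), 2026-08-25; `bears_on: R4-O/T1|T1a` (the wrapper's (K1) stays DISPLAYED; moves no node counter).  No existing file touched.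
-/

noncomputable section

namespace Summit.QuantumFields.BalabanUV.Beta.StraightSourceK1Row

open Finset
open scoped BigOperators
open Literature.MathematicalPhysics.QuantumFieldTheory.Balaban1983to89
open Literature.MathematicalPhysics.QuantumFieldTheory.Balaban1983to89.Beta
open AffineAveraging (Form0 Form1 Form2 Site unitVec dz curv curvAdj codiff₁ box toSite contourSum)
open AffineReproduction (contourSumAdj)
open AveragingHessianKernels (Bond δ1 straightCount)
open AveragingHessianKernelsRooted (linCountAt)
open KKTFluctuationKernel (delta1 delta1_apply)
open KKTFluctuationEnergy (lip1 lip1_contourSumAdj)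
open KernelSpecInstance (wH wΦ)
open ResolventComposition (Hcol HΦcol HcolSum HΦcolSum Hcol_apply HΦcol_apply curvAdj_curv_Hcol curvAdj_curv_HcolSum contourSum_HcolSum
  HcolSum_bdd_summable HΦcol_bdd tsum_sum_mul_indicator)
open OneStepResolventKernel (Fib KInv)
open BalabanStepJets (lamCoeffOf)
open Summit.QuantumFields.BalabanUV.Beta.BorderedHessian (lip1_delta1_left summable_delta1)
open Summit.QuantumFields.BalabanUV.Beta.GAN24.TransverseDictionary (wΦ_symm)
open Summit.QuantumFields.BalabanUV.Beta.SymAveragingHessianCounts (symLinKerAt symLinKerAt_eq_zero)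
open Summit.QuantumFields.BalabanUV.Beta.CoclosedCovectorLinearRows (straightCount_real)
open Summit.QuantumFields.BalabanUV.Beta.CoclosedCovectorLinearRowsNear (lip1_symLinKerAt_of_bounded lip1_linCountAt_of_bounded summable_of_near)
open Summit.QuantumFields.BalabanUV.Beta.StraightColumnK1Row (lamCovector_eq_neg_lip1 codiff₁_lamCovector mapForm_δ1_eq_delta1)

variable {d N : ℕ} [NeZero N]

/-! ## §1 The superposition's `Λ′` is minus its own multiplier -/

/-- [folklore] **`λ′ = −Φ^{H}_{T,c}`** for the minimiser superposition `h = Σ_{t∈T} c t · ℋ_N(·; t)`: `Σ'_x Σ_{κ′} lamCoeffOf (KInv N) N μ y κ′ x · HcolSum T c κ′ x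
= −HΦcolSum T c μ y` ((EL) for `ℋ_{(μ,y)}`, the adjunction `𝒬 ↔ 𝒬ᵀ`, (Q) for the superposition, reciprocity `wΦ κ l z = wΦ l κ (−z)`). -/
theorem lamCovector_HcolSum (T : Finset (Fin (d + 1) × Site (d + 1))) (c : Fin (d + 1) × Site (d + 1) → ℝ) (μ : Fin (d + 1))
    (y : Site (d + 1)) :
    (∑' x, ∑ κ', lamCoeffOf (KInv (N := N)) N μ y κ' x * HcolSum (N := N) T c κ' x) = -HΦcolSum (N := N) T c μ y := by
  obtain ⟨C, _, hHs, _⟩ := HcolSum_bdd_summable (N := N) T c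
  obtain ⟨CΦ, _, hΦ⟩ := HΦcol_bdd (N := N) (d := d)
  rw [lamCovector_eq_neg_lip1, curvAdj_curv_Hcol]
  congr 1
  have hc : lip1 (contourSumAdj N (HΦcol (N := N) μ y)) (HcolSum (N := N) T c)
      = lip1 (HcolSum (N := N) T c) (contourSumAdj N (HΦcol (N := N) μ y)) :=
    tsum_congr fun x => Finset.sum_congr rfl fun κ _ => mul_comm _ _
  rw [hc, lip1_contourSumAdj (N := N) hHs (hΦ μ y)]
  have e : ∀ y'' : Site (d + 1), ∑ κ, HΦcol (N := N) μ y κ y'' * contourSum N (HcolSum (N := N) T c) κ y''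
      = ∑ t ∈ T, c t * ∑ κ, HΦcol (N := N) μ y κ y'' * (if y'' = t.2 ∧ κ = t.1 then (1 : ℝ) else 0) := by
    intro y''
    simp_rw [contourSum_HcolSum, Finset.mul_sum]
    rw [Finset.sum_comm]
    exact Finset.sum_congr rfl fun t _ => Finset.sum_congr rfl fun κ _ => by ring
  have hs : ∀ t ∈ T, Summable fun y'' : Site (d + 1) =>
      c t * ∑ κ, HΦcol (N := N) μ y κ y'' * (if y'' = t.2 ∧ κ = t.1 then (1 : ℝ) else 0) := fun t _ =>
    summable_of_ne_finset_zero (s := {t.2}) fun y'' hy => by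
      rw [Finset.mem_singleton] at hy
      rw [Finset.sum_eq_zero fun κ _ => by rw [if_neg (fun h => hy h.1), mul_zero], mul_zero]
  rw [tsum_congr e, Summable.tsum_finsetSum hs]
  simp_rw [tsum_mul_left, tsum_sum_mul_indicator]
  show ∑ t ∈ T, c t * HΦcol (N := N) μ y t.1 t.2 = HΦcolSum (N := N) T c μ y
  refine Finset.sum_congr rfl fun t _ => ?_
  rw [HΦcol_apply, HΦcol_apply, wΦ_symm, neg_sub]

/-- [folklore] The superposition's `Λ′`-covector is bounded. -/
theorem abs_lamCovector_HcolSum_le (T : Finset (Fin (d + 1) × Site (d + 1))) (c : Fin (d + 1) × Site (d + 1) → ℝ) :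
    ∃ C : ℝ, ∀ μ y, |∑' x, ∑ κ', lamCoeffOf (KInv (N := N)) N μ y κ' x * HcolSum (N := N) T c κ' x| ≤ C := by
  obtain ⟨C, _, _, hΦb⟩ := HcolSum_bdd_summable (N := N) T c
  exact ⟨C, fun μ y => by rw [lamCovector_HcolSum, abs_neg]; exact hΦb μ y⟩

/-- [folklore] The superposition's `Λ′`-covector is coarse co-closed (part 3's `codiff₁_lamCovector`). -/
theorem codiff₁_lamCovector_HcolSum (T : Finset (Fin (d + 1) × Site (d + 1))) (c : Fin (d + 1) × Site (d + 1) → ℝ) :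
    codiff₁ (fun μ y => ∑' x, ∑ κ', lamCoeffOf (KInv (N := N)) N μ y κ' x * HcolSum (N := N) T c κ' x) = 0 := by
  obtain ⟨C, hHb, hHs, _⟩ := HcolSum_bdd_summable (N := N) T c
  exact codiff₁_lamCovector (N := N) hHb hHs

/-! ## §2 (K1) for the superposition -/

/-- [folklore] **THE LEFT-HAND SIDE**: `(E″(1) h)(u) = Σ'_y Σ_μ HΦcolSum T c μ y · straightCount N μ y u` ((EL) `curvAdj_curv_HcolSum` + the `𝒬 ↔ 𝒬ᵀ` duality on the
indicator of `u`). -/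
theorem curvAdj_curv_HcolSum_apply_eq_pairing_straightCount (T : Finset (Fin (d + 1) × Site (d + 1))) (c : Fin (d + 1) × Site (d + 1) → ℝ)
    (u : Bond (d + 1)) :
    curvAdj (curv (HcolSum (N := N) T c)) u.1 u.2 = ∑' y, ∑ μ, HΦcolSum (N := N) T c μ y * (straightCount N μ y u : ℝ) := by
  obtain ⟨C, _, _, hΦb⟩ := HcolSum_bdd_summable (N := N) T c
  rw [curvAdj_curv_HcolSum, ← lip1_delta1_left u.1 u.2 (contourSumAdj N (HΦcolSum (N := N) T c)),
    lip1_contourSumAdj (N := N) (summable_delta1 u.1 u.2) hΦb]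
  refine tsum_congr fun y => Finset.sum_congr rfl fun μ _ => ?_
  rw [straightCount_real, mapForm_δ1_eq_delta1]

/-- [folklore] `⟨λ′, straightCount · · u⟩ = −(E″(1) h)(u)` for the superposition. -/
theorem lip1_lamCovector_HcolSum_straightCount (T : Finset (Fin (d + 1) × Site (d + 1))) (c : Fin (d + 1) × Site (d + 1) → ℝ) (u : Bond (d + 1)) :
    lip1 (fun μ y => ∑' x, ∑ κ', lamCoeffOf (KInv (N := N)) N μ y κ' x * HcolSum (N := N) T c κ' x)
        (fun μ y => (straightCount N μ y u : ℝ)) = -(curvAdj (curv (HcolSum (N := N) T c)) u.1 u.2) := by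
  rw [curvAdj_curv_HcolSum_apply_eq_pairing_straightCount, ← tsum_neg]
  unfold lip1
  refine tsum_congr fun y => ?_
  rw [← Finset.sum_neg_distrib]
  refine Finset.sum_congr rfl fun μ _ => ?_
  dsimp only
  rw [lamCovector_HcolSum, neg_mul]

/-- [folklore] **(K1) FOR THE STRAIGHT SUPERPOSITION, STRAIGHT ROWS** (`α = −1`). -/
theorem K1_row_straight_source_straight (T : Finset (Fin (d + 1) × Site (d + 1))) (c : Fin (d + 1) × Site (d + 1) → ℝ) (u : Bond (d + 1)) :
    curvAdj (curv (HcolSum (N := N) T c)) u.1 u.2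
      = -∑' y, ∑ μ, (∑' x, ∑ κ', lamCoeffOf (KInv (N := N)) N μ y κ' x * HcolSum (N := N) T c κ' x) * (straightCount N μ y u : ℝ) := by
  have h := lip1_lamCovector_HcolSum_straightCount (N := N) T c u
  unfold lip1 at h
  rw [h, neg_neg]

/-- [folklore] **(K1) FOR THE STRAIGHT SUPERPOSITION, SYMMETRISED ROWS** (`α = −N^{d+1}`; root `toSite r` in the block): for `h = Σ_{t∈T} c t · ℋ_N(·; t)`,
`(E″(1) h)(u) = −N^{d+1} · Σ'_y Σ_μ λ′(μ,y) · symLinKerAt (toSite r) N μ y u`. -/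
theorem K1_row_straight_source_sym (T : Finset (Fin (d + 1) × Site (d + 1))) (c : Fin (d + 1) × Site (d + 1) → ℝ)
    {r : Fin (d + 1) → ℕ} (hr : r ∈ box (d + 1) N) (u : Bond (d + 1)) :
    curvAdj (curv (HcolSum (N := N) T c)) u.1 u.2
      = -((N : ℝ) ^ (d + 1)) * ∑' y, ∑ μ, (∑' x, ∑ κ', lamCoeffOf (KInv (N := N)) N μ y κ' x * HcolSum (N := N) T c κ' x)
          * symLinKerAt (toSite r) N μ y u := by
  obtain ⟨C, hC⟩ := abs_lamCovector_HcolSum_le (N := N) T c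
  have hN : 0 < N := Nat.pos_of_ne_zero (NeZero.ne N)
  have hNd : (N : ℝ) ^ (d + 1) ≠ 0 := pow_ne_zero _ (Nat.cast_ne_zero.mpr (NeZero.ne N))
  have key := lip1_symLinKerAt_of_bounded hC (codiff₁_lamCovector_HcolSum (N := N) T c) hN hr u
  rw [lip1_lamCovector_HcolSum_straightCount] at key
  unfold lip1 at key
  rw [key, ← mul_assoc, neg_mul, mul_inv_cancel₀ hNd, neg_mul, one_mul, neg_neg]

/-- [folklore] The same row with the displayed order of summation `Σ_μ Σ'_y`. -/
theorem K1_row_straight_source_sym' (T : Finset (Fin (d + 1) × Site (d + 1))) (c : Fin (d + 1) × Site (d + 1) → ℝ)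
    {r : Fin (d + 1) → ℕ} (hr : r ∈ box (d + 1) N) (u : Bond (d + 1)) :
    curvAdj (curv (HcolSum (N := N) T c)) u.1 u.2
      = -((N : ℝ) ^ (d + 1)) * ∑ μ, ∑' y, (∑' x, ∑ κ', lamCoeffOf (KInv (N := N)) N μ y κ' x * HcolSum (N := N) T c κ' x)
          * symLinKerAt (toSite r) N μ y u := by
  have hN : 0 < N := Nat.pos_of_ne_zero (NeZero.ne N)
  have hs : ∀ μ ∈ (Finset.univ : Finset (Fin (d + 1))), Summable fun y =>
      (∑' x, ∑ κ', lamCoeffOf (KInv (N := N)) N μ y κ' x * HcolSum (N := N) T c κ' x) * symLinKerAt (toSite r) N μ y u :=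
    fun μ _ => summable_of_near hN u.2 fun y hy => by rw [symLinKerAt_eq_zero hr hy, mul_zero]
  rw [K1_row_straight_source_sym T c hr u, Summable.tsum_finsetSum hs]

/-- [folklore] **(K1) FOR THE STRAIGHT SUPERPOSITION, ROOTED COMB ROWS** (`α = −1`). -/
theorem K1_row_straight_source_comb (T : Finset (Fin (d + 1) × Site (d + 1))) (c : Fin (d + 1) × Site (d + 1) → ℝ)
    {r : Fin (d + 1) → ℕ} (hr : r ∈ box (d + 1) N) (u : Bond (d + 1)) :
    curvAdj (curv (HcolSum (N := N) T c)) u.1 u.2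
      = -∑' y, ∑ μ, (∑' x, ∑ κ', lamCoeffOf (KInv (N := N)) N μ y κ' x * HcolSum (N := N) T c κ' x)
          * (linCountAt (toSite r) N μ y u : ℝ) := by
  obtain ⟨C, hC⟩ := abs_lamCovector_HcolSum_le (N := N) T c
  have hN : 0 < N := Nat.pos_of_ne_zero (NeZero.ne N)
  have key := lip1_linCountAt_of_bounded hC (codiff₁_lamCovector_HcolSum (N := N) T c) hN hr u
  rw [lip1_lamCovector_HcolSum_straightCount] at key
  unfold lip1 at key
  rw [key, neg_neg]

end Summit.QuantumFields.BalabanUV.Beta.StraightSourceK1Row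

end
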